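import Literature.MathematicalPhysics.QuantumFieldTheory.Balaban1983to89.Beta.AliasRatioStrip

/-!
# Beta/AliasRatioDerivs — ALL-ORDER, k-UNIFORM DERIVATIVE BOUNDS for the alias ratios `t_λ(p′) − 1` of Bałaban's
# symbol (1.62) at U = 1: Cauchy iteration on shrinking polydiscs for jointly ANALYTIC functions on `ℂ^d`, and the
# structural analyticity of `tSubOne` (β sub-cell row an1, node L1-STRIP-DERIVS; HOME/BETA/AN1.md §15.4 (a)–(b))

HONEST FRAMING (cell `pub-balaban`, BETA-SPEC): discharging the flow-side hypothesis `BetaPertH` of Bałaban's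
[Balaban1987RG1] Theorem 2 would make the ultraviolet STABILITY of four-dimensional pure Yang–Mills lattice gauge
theory UNCONDITIONAL (in the interval-hypothesis sense of [Balaban1989LargeFieldII] p. 355) — a real constructive-QFT
result; it is NOT the continuum limit and NOT the Clay problem.  (Gloss 1, BETA-SPEC v1.8d l. 17–22, GAPS G-ref2-14 (a)
/ G-ref2-20 (a) / G-ref2-24 (a), verbatim: «UNCONDITIONAL» in [Balaban1989LargeFieldII] (B16) p. 355's interval-hypothesis
sense ONLY (`FlowStepRuns.p355Unconditional_of_partialSums` keeps `hnodes`); the located leaves G-adv3-2 (left inequality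
of (0.1)/(2.50), d = 4), G-adv3-1 (U2 transfer of B14 Cor. 3's lower bound) and `SecondExpLeaf` REMAIN.  Gloss 2,
BETA-SPEC v1.9e l. 23–25, beta-ref C-beta-78, BINDING: «UNCONDITIONAL» = `Beta.Assembly.EventualForm`-unconditional — the
END statement with the interval hypothesis removed, (0.31) in DEFECTED form on all lattices
(`PrefixAbsorption.thm2Defected_of_eventualForm`), admissible couplings shrunk to g ≤ g⋆; NOT «B12 Theorem 2 as printed»
(`eventualForm_not_thm2Printed`, RULING (R6)); never the continuum limit / mass gap / Clay.)  This module asserts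
NOTHING about Bałaban's β-functions and introduces no `def … : Prop` hypothesis shape.  It proves [folklore]
several-complex-variables calculus (Cauchy's
estimate iterated on polydiscs) and applies it to the objects of `Beta.AliasRatioStrip`, which continue the printed
DEFINITIONS [Balaban1984PropagatorsI] (T. Bałaban, Propagators and renormalization transformations for lattice gauge
theories I, Commun. Math. Phys. **95** (1984) 17–40; INDEX B5) (1.61)–(1.62) p. 28.  Nothing printed is used as a
hypothesis; no upstream symbol is re-defined, no upstream inequality re-proved.

## Printed context (verbatim, with page; CONTEXT only)

* [Balaban1983RegularityDecay] (Commun. Math. Phys. **89** (1983) 571–597; INDEX B4) p. 586 [PDF 16], after (2.51):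
  «The expression is a function of p′ and can be extended as an analytic function to some neighbourhood of [−π,π]^d.
  It is more troublesome, but equally elementary, to prove that this neighbourhood can be chosen independently of j
  and that the expression is bounded also in this neighbourhood.»  The standard consequence — bounds on ALL
  derivatives, uniform in j, by Cauchy's estimate — is what this module writes out in the kernel for the alias
  ratios of (1.62) (`Beta.AliasRatioStrip.statement_St` gave the neighbourhood, holomorphy and the bound).
* Cauchy's estimate: J. B. Conway, Functions of One Complex Variable I, IV.2.14 (Mathlib
  `Complex.norm_deriv_le_of_forall_mem_sphere_norm_le`); its several-variables form, C. Laurent-Thiébaut, Holomorphic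
  Function Theory in Several Variables (Springer 2011), Ch. I Theorem 2.3 (2.4) [PDF p. 14]: «|D^α f(a)| ≤ α!/r^α ·
  sup_{P(a,r)} |f|» for f holomorphic on the polydisc P(a,r).  Mathlib (at the pin of this tree) has no polydisc Cauchy
  formula; the module proves the weaker ITERATED form (constant `m^m/R^m`, `m = |α|`, from `m` one-variable Cauchy
  estimates of radius `R/m`) which is all that k-uniform derivative bounds need.

## Relation to the tree's existing engines (nothing re-proved)

* `B4StripCauchy.norm_deriv_slice_le` / `one_coordinate_step` (INDEX B4): the FIRST slice derivative, hypotheses on the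
  fat region `Fat d r`, conclusion on the thin strip `Strip d κ` — not iterable (no shrinking family of regions).
* `Literature.Analysis.Complex.SCV.norm_fderiv_apply_le` + `SCV.differentiableOn_fderiv_apply` and their iteration
  `B12Ineq45.norm_dirIter_le` (INDEX B12 (4.5)): arbitrary directions `v_p`, hypotheses `DifferentiableOn ℂ f U` on an
  OPEN set `U ⊇ polydisc`.  The present engine is the CLOSED-coordinate-polydisc variant from POINTWISE analyticity
  (`AnalyticAt` at each point of `PolyBox c R`, holomorphy of the derivatives by Mathlib `AnalyticAt.fderiv`): this is
  the form the CLOSED momentum zone needs — a point `q` with `|Re q_ν| = π` is the centre of the closed polydisc of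
  the full radius `rOf d` inside the closed fat region `Fat d (rOf d)`, with no open neighbourhood to spare — and it
  yields the joint analyticity of `t_λ − 1` in `p′` (§2) as a by-product.  The two engines are not merged: neither
  set of hypotheses implies the other as stated, and no statement of either upstream module is restated here.

## What is proved

§1 (GENERAL ENGINE, any `g : (Fin d → ℂ) → ℂ`).  `PolyBox c R = {q | ∀ ν, ‖q_ν − c_ν‖ ≤ R}` (closed polydisc);
`sliceDeriv g μ q = ∂g/∂z_μ (q)` (the derivative of the coordinate slice); `iterSliceDeriv g α` for a list
`α = [μ₁, …, μ_m]` of coordinates (`∂_{μ₁} ⋯ ∂_{μ_m} g`).  For JOINTLY ANALYTIC `g` (`AnalyticAt ℂ g q`):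
`sliceDeriv_eq_fderiv` (`∂_μ g(q) = Dg(q)·e_μ`), `analyticAt_sliceDeriv` / `analyticAt_iterSliceDeriv` (derivatives of
analytic functions are analytic — Mathlib `AnalyticAt.fderiv`), the Cauchy step on shrinking polydiscs
`norm_sliceDeriv_le : (analytic, ‖g‖ ≤ M on PolyBox c R) → ‖∂_μ g‖ ≤ M/ρ on PolyBox c (R − ρ)`, its iteration
`norm_iterSliceDeriv_le : ‖∂^α g‖ ≤ M/ρ^m on PolyBox c (R − mρ)` and the centre estimate
`norm_iterSliceDeriv_center_le : ‖∂^α g(c)‖ ≤ M·(m/R)^m` (`m = |α|`, `R > 0`).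
§2 (STRUCTURAL ANALYTICITY, every `n ≥ 1`).  `analyticAt_uFactor_zero/_ne/_coord`, `analyticAt_U`, `analyticAt_DeltaXi`,
`analyticAt_DeltaXi_shift`, `analyticAt_R`, `analyticAt_numT`, `analyticAt_denT` and
`analyticAt_tSubOne : AnalyticAt ℂ (tSubOne n λ) q` at every point `q` of the fat region `Fat d r` (`r ≤ 1/4`,
`d r² ≤ 1/16`) — strengthening `Beta.AliasRatioStrip.differentiableAt_tSubOne` (one complex variable: holomorphic on an
open set ⇒ analytic, Mathlib `DifferentiableOn.analyticAt`; then compositions with the coordinate projections, finite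
products and sums, and quotients by non-vanishing analytic functions).
§3 (THE COROLLARIES FOR `t_λ − 1`, uniform in k).  With `M_T(d)`, `rOf d = 1/(4(d+1))`, `C_T⁽⁴⁾(d)` of
`Beta.AliasRatioStrip`: `norm_iterSliceDeriv_tSubOne_le : ‖∂^α tSubOne n λ (q)‖ ≤ M_T(d)·(m/rOf d)^m` for EVERY
`n ≥ 1`, `λ`, every list `α` (`m = |α|`) and every `q ∈ Strip d κ`, `0 ≤ κ ≤ rOf d` (in particular every real momentum
of the closed zone, `norm_iterSliceDeriv_tSubOne_le_real`); and the VANISHING-ORDER bounds at `p = 0`: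
`norm_iterSliceDeriv_tSubOne_le_small : (∀ ν, ‖q_ν‖ ≤ ρ, 0 < ρ ≤ rOf d) → ‖∂^α tSubOne n λ (q)‖ ≤
C_T⁽⁴⁾(d)·16d²ρ⁴·(m/ρ)^m`, i.e. `≤ 16d²·m^m·C_T⁽⁴⁾(d)·ρ^{4−m}` for `m ≤ 4` (`norm_iterSliceDeriv_tSubOne_le_vanishing`).

## What this is for, and what it is NOT

This makes HOME/BETA/AN1.md §15.4 (a) (all-order k-uniform Cauchy bounds) and (b) (the mixed statement
`|∂^α(t_λ − 1)(p′)| ≤ C_α min(1, |p′|^{4−|α|})`) KERNEL statements; together with `Beta.AliasRatioStrip` (v1.1) the an1-side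
content of BETA-SPEC 7.8 (ii) («strip/derivative versions of an1's Theorems A/B at U = 1») is entirely in the kernel for
the alias ratios `t_λ` (the remaining factors `F_k`, `ω_λ` of `Beta.SymbolExpansion.sigmaSym_factorisation` are explicit).
NOT covered: anything at U ≠ 1, the Woodbury blocks (1.70)–(1.83), the background-field vertices (BETA-SPEC 7.8 (iii)),
and — of course — any statement about β.  Value = kernel certificate of a located (L1) input, NOT summit progress.
v1.0.1 (DOCFIX, header only, GAPS G-ref2-24 (a)): glosses 1–2 of the honest framing carried verbatim; no declaration changed.
-/

namespace Literature.MathematicalPhysics.QuantumFieldTheory.Balaban1983to89.Beta.AliasRatioDerivs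

open Finset Metric
open Literature.MathematicalPhysics.QuantumFieldTheory.Balaban1983to89.B4Strip
open Literature.MathematicalPhysics.QuantumFieldTheory.Balaban1983to89.B4StripCauchy
open Literature.MathematicalPhysics.QuantumFieldTheory.Balaban1983to89.B4StripSums (R DeltaXi_shift_ne_zero)
open Literature.MathematicalPhysics.QuantumFieldTheory.Balaban1983to89.Beta.AliasRatioStrip

noncomputable section

variable {d : ℕ}

/-! ## §1. General engine: slice derivatives of jointly analytic functions on `ℂ^d`; Cauchy on shrinking polydiscs -/

/-- the closed POLYDISC of radius `R` about `c`: `{q | ∀ ν, ‖q_ν − c_ν‖ ≤ R}`. [folklore] -/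
def PolyBox (c : Fin d → ℂ) (R : ℝ) : Set (Fin d → ℂ) := {q | ∀ ν, ‖q ν - c ν‖ ≤ R}

/-- the SLICE DERIVATIVE `∂g/∂z_μ (q)`: the complex derivative at `q_μ` of the coordinate slice `w ↦ g(q with q_μ ↦ w)`
(the quantity bounded by `B4StripCauchy.norm_deriv_slice_le`). [folklore] -/
def sliceDeriv (g : (Fin d → ℂ) → ℂ) (μ : Fin d) : (Fin d → ℂ) → ℂ :=
  fun q => deriv (fun w => g (Function.update q μ w)) (q μ)

/-- the ITERATED slice derivative along a list of coordinates, outermost first: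
`iterSliceDeriv g [μ₁, μ₂, …, μ_m] = ∂_{μ₁} (∂_{μ₂} ⋯ (∂_{μ_m} g))`. [folklore] -/
def iterSliceDeriv (g : (Fin d → ℂ) → ℂ) : List (Fin d) → (Fin d → ℂ) → ℂ
  | [] => g
  | μ :: α => sliceDeriv (iterSliceDeriv g α) μ

/-- no derivative: `iterSliceDeriv g [] = g`. [folklore] -/
@[simp] theorem iterSliceDeriv_nil (g : (Fin d → ℂ) → ℂ) : iterSliceDeriv g [] = g := rfl

/-- one more derivative, outermost: `iterSliceDeriv g (μ :: α) = ∂_μ (iterSliceDeriv g α)`. [folklore] -/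
@[simp] theorem iterSliceDeriv_cons (g : (Fin d → ℂ) → ℂ) (μ : Fin d) (α : List (Fin d)) :
    iterSliceDeriv g (μ :: α) = sliceDeriv (iterSliceDeriv g α) μ := rfl

/-- the centre belongs to every polydisc of nonnegative radius. [folklore] -/
theorem mem_polyBox_self (c : Fin d → ℂ) {R : ℝ} (hR : 0 ≤ R) : c ∈ PolyBox c R := fun ν => by simpa using hR

/-- polydiscs are monotone in the radius. [folklore] -/
theorem polyBox_mono (c : Fin d → ℂ) {R R' : ℝ} (h : R ≤ R') : PolyBox c R ⊆ PolyBox c R' :=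
  fun _ hq ν => (hq ν).trans h

/-- moving one coordinate of a point of `PolyBox c (R − ρ)` inside its closed disc of radius `ρ` stays in `PolyBox c R`.
[folklore] -/
theorem update_mem_polyBox {c q : Fin d → ℂ} {R ρ : ℝ} (hρ : 0 ≤ ρ) (hq : q ∈ PolyBox c (R - ρ)) (μ : Fin d)
    {w : ℂ} (hw : w ∈ closedBall (q μ) ρ) : Function.update q μ w ∈ PolyBox c R := by
  intro ν
  by_cases h : ν = μ
  · subst h
    simp only [Function.update_self]
    rw [mem_closedBall, dist_eq_norm] at hw
    calc ‖w - c ν‖ = ‖(w - q ν) + (q ν - c ν)‖ := by ring_nf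
      _ ≤ ‖w - q ν‖ + ‖q ν - c ν‖ := norm_add_le _ _
      _ ≤ ρ + (R - ρ) := add_le_add hw (hq ν)
      _ = R := by ring
  · simp only [Function.update_of_ne h]
    linarith [hq ν]

/-- **`∂_μ g(q) = Dg(q)·e_μ`** for `g` (Fréchet-)differentiable at `q` (chain rule with Mathlib `hasDerivAt_update`).
[folklore] -/
theorem sliceDeriv_eq_fderiv {g : (Fin d → ℂ) → ℂ} {q : Fin d → ℂ} (hg : DifferentiableAt ℂ g q) (μ : Fin d) :
    sliceDeriv g μ q = fderiv ℂ g q (Pi.single μ 1) := by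
  unfold sliceDeriv
  have h1 : HasDerivAt (Function.update q μ) (Pi.single μ (1 : ℂ)) (q μ) := hasDerivAt_update q μ (q μ)
  have h2 : HasFDerivAt g (fderiv ℂ g q) (Function.update q μ (q μ)) := by
    rw [Function.update_eq_self]; exact hg.hasFDerivAt
  exact (h2.comp_hasDerivAt (q μ) h1).deriv

/-- **the slice derivative of an analytic function is analytic** (jointly in `q ∈ ℂ^d`; Mathlib `AnalyticAt.fderiv`).
[folklore] -/
theorem analyticAt_sliceDeriv {g : (Fin d → ℂ) → ℂ} {q : Fin d → ℂ} (hg : AnalyticAt ℂ g q) (μ : Fin d) :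
    AnalyticAt ℂ (sliceDeriv g μ) q := by
  have hG : AnalyticAt ℂ (fun p => fderiv ℂ g p (Pi.single μ 1)) q := by
    have h := ((ContinuousLinearMap.apply ℂ ℂ (Pi.single μ (1 : ℂ))).analyticAt (fderiv ℂ g q)).comp hg.fderiv
    simpa [Function.comp_def] using h
  refine hG.congr ?_
  filter_upwards [hg.eventually_analyticAt] with p hp
  exact (sliceDeriv_eq_fderiv hp.differentiableAt μ).symm

/-- iterated slice derivatives of an analytic function are analytic. [folklore] -/
theorem analyticAt_iterSliceDeriv {g : (Fin d → ℂ) → ℂ} {q : Fin d → ℂ} (hg : AnalyticAt ℂ g q) :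
    ∀ α : List (Fin d), AnalyticAt ℂ (iterSliceDeriv g α) q
  | [] => hg
  | μ :: α => (analyticAt_iterSliceDeriv hg α |> fun h => analyticAt_sliceDeriv h μ)

/-- analyticity on a set propagates to all iterated slice derivatives on the same set. [folklore] -/
theorem analyticAt_iterSliceDeriv_of_forall {g : (Fin d → ℂ) → ℂ} {S : Set (Fin d → ℂ)}
    (hg : ∀ q ∈ S, AnalyticAt ℂ g q) (α : List (Fin d)) : ∀ q ∈ S, AnalyticAt ℂ (iterSliceDeriv g α) q :=
  fun q hq => analyticAt_iterSliceDeriv (hg q hq) α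

/-- the coordinate slice of an analytic function through an analytic point is differentiable there. [folklore] -/
theorem differentiableAt_slice_of_analyticAt {g : (Fin d → ℂ) → ℂ} {p : Fin d → ℂ} (μ : Fin d) {w : ℂ}
    (hg : AnalyticAt ℂ g (Function.update p μ w)) :
    DifferentiableAt ℂ (fun u => g (Function.update p μ u)) w := by
  have hupd : DifferentiableAt ℂ (fun u : ℂ => Function.update p μ u) w := (hasDerivAt_update p μ w).differentiableAt
  exact hg.differentiableAt.comp w hupd

/-- **CAUCHY'S ESTIMATE ON SHRINKING POLYDISCS** (Conway IV.2.14): if `g` is analytic at every point of `PolyBox c R` and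
`‖g‖ ≤ M` there, then `‖∂_μ g(q)‖ ≤ M/ρ` at every `q ∈ PolyBox c (R − ρ)`, `0 < ρ`. [folklore] -/
theorem norm_sliceDeriv_le (g : (Fin d → ℂ) → ℂ) {c : Fin d → ℂ} {R ρ M : ℝ} (hρ : 0 < ρ)
    (hg : ∀ q ∈ PolyBox c R, AnalyticAt ℂ g q) (hM : ∀ q ∈ PolyBox c R, ‖g q‖ ≤ M)
    {q : Fin d → ℂ} (hq : q ∈ PolyBox c (R - ρ)) (μ : Fin d) : ‖sliceDeriv g μ q‖ ≤ M / ρ := by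
  unfold sliceDeriv
  apply Complex.norm_deriv_le_of_forall_mem_sphere_norm_le hρ
  · refine DifferentiableOn.diffContOnCl_ball ?_ (subset_refl (closedBall (q μ) ρ))
    intro w hw
    have hq' : Function.update q μ w ∈ PolyBox c R := update_mem_polyBox hρ.le hq μ hw
    have := differentiableAt_slice_of_analyticAt μ (hg _ hq')
    exact (by simpa [Function.update_idem] using this : DifferentiableAt ℂ (fun u => g (Function.update q μ u)) w)
      |>.differentiableWithinAt
  · intro w hw
    exact hM _ (update_mem_polyBox hρ.le hq μ (sphere_subset_closedBall hw))

/-- **ITERATED CAUCHY ESTIMATE**: `‖∂^α g(q)‖ ≤ M/ρ^m` on `PolyBox c (R − mρ)`, `m = |α|`, whenever `mρ ≤ R`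
(induction on `α`, shrinking the polydisc by `ρ` at each step). [folklore] -/
theorem norm_iterSliceDeriv_le (g : (Fin d → ℂ) → ℂ) {c : Fin d → ℂ} {R M ρ : ℝ} (hρ : 0 < ρ)
    (hg : ∀ q ∈ PolyBox c R, AnalyticAt ℂ g q) (hM : ∀ q ∈ PolyBox c R, ‖g q‖ ≤ M) :
    ∀ (α : List (Fin d)), (α.length : ℝ) * ρ ≤ R →
      ∀ q ∈ PolyBox c (R - α.length * ρ), ‖iterSliceDeriv g α q‖ ≤ M / ρ ^ α.length
  | [], _, q, hq => by simpa using hM q (by simpa using hq)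
  | μ :: α, hlen, q, hq => by
    have hlen' : (α.length : ℝ) * ρ ≤ R := by
      simp only [List.length_cons, Nat.cast_succ] at hlen; nlinarith
    have IH := norm_iterSliceDeriv_le g hρ hg hM α hlen'
    have hgα : ∀ p ∈ PolyBox c (R - α.length * ρ), AnalyticAt ℂ (iterSliceDeriv g α) p :=
      fun p hp => analyticAt_iterSliceDeriv (hg p (polyBox_mono c (by nlinarith [hρ.le]) hp)) α
    have hq' : q ∈ PolyBox c ((R - α.length * ρ) - ρ) := by
      simp only [List.length_cons, Nat.cast_succ] at hq
      convert hq using 2; ring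
    have h := norm_sliceDeriv_le (iterSliceDeriv g α) hρ hgα IH hq' μ
    rw [iterSliceDeriv_cons, List.length_cons, pow_succ, ← div_div]
    exact h

/-- **THE CENTRE ESTIMATE `‖∂^α g(c)‖ ≤ M·(m/R)^m`** (`m = |α|`, `R > 0`; radius `ρ = R/m` per step). [folklore] -/
theorem norm_iterSliceDeriv_center_le (g : (Fin d → ℂ) → ℂ) {c : Fin d → ℂ} {R M : ℝ} (hR : 0 < R)
    (hg : ∀ q ∈ PolyBox c R, AnalyticAt ℂ g q) (hM : ∀ q ∈ PolyBox c R, ‖g q‖ ≤ M) (α : List (Fin d)) :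
    ‖iterSliceDeriv g α c‖ ≤ M * ((α.length : ℝ) / R) ^ α.length := by
  rcases Nat.eq_zero_or_pos α.length with h0 | hpos
  · have hα : α = [] := List.length_eq_zero_iff.mp h0
    subst hα
    simpa using hM c (mem_polyBox_self c hR.le)
  · have hm : (0 : ℝ) < α.length := by exact_mod_cast hpos
    set ρ : ℝ := R / α.length with hρdef
    have hρ : 0 < ρ := div_pos hR hm
    have hlen : (α.length : ℝ) * ρ ≤ R := by rw [hρdef, mul_div_cancel₀ _ hm.ne']
    have hc : c ∈ PolyBox c (R - α.length * ρ) := by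
      rw [hρdef, mul_div_cancel₀ _ hm.ne', sub_self]; exact mem_polyBox_self c le_rfl
    have h := norm_iterSliceDeriv_le g hρ hg hM α hlen c hc
    calc ‖iterSliceDeriv g α c‖ ≤ M / ρ ^ α.length := h
      _ = M * ((α.length : ℝ) / R) ^ α.length := by
          rw [hρdef, div_pow, div_pow, div_div_eq_mul_div, mul_div_assoc]

/-! ## §2. Structural analyticity of the continued alias objects on the fat region, uniform in `n ≥ 1` -/

/-- the coordinate projections `p ↦ p_μ` are analytic (continuous linear). [folklore] -/
theorem analyticAt_eval (μ : Fin d) (q : Fin d → ℂ) : AnalyticAt ℂ (fun p : Fin d → ℂ => p μ) q :=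
  (ContinuousLinearMap.proj (R := ℂ) (φ := fun _ : Fin d => ℂ) μ).analyticAt q

/-- `S_ξ` is entire, hence analytic everywhere. [folklore] -/
theorem analyticAt_Sxi (n : ℕ) (z : ℂ) : AnalyticAt ℂ (Sxi n) z := (differentiable_Sxi n).analyticAt z

/-- the continued `l = 0` weight `u_n(0;·)` (removable point filled) is analytic on `|Re z| < 2π`. [folklore] -/
theorem analyticAt_uFactor_zero (n : ℕ) (hn : 1 ≤ n) {z : ℂ} (hx : |z.re| < 2 * Real.pi) :
    AnalyticAt ℂ (uFactor n 0) z := by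
  have hO : IsOpen {w : ℂ | |w.re| < 2 * Real.pi} :=
    isOpen_lt (continuous_abs.comp Complex.continuous_re) continuous_const
  exact DifferentiableOn.analyticAt (s := {w : ℂ | |w.re| < 2 * Real.pi})
    (fun w hw => (differentiableAt_uFactor_zero n hn hw).differentiableWithinAt) (hO.mem_nhds hx)

/-- the shifted weight `u_n(j;·)`, `j ≠ 0`, is analytic wherever its denominator `S_ξ(· + 2πj)` is nonzero. [folklore] -/
theorem analyticAt_uFactor_ne (n j : ℕ) (hj : j ≠ 0) {z : ℂ} (h : Sxi n (z + 2 * Real.pi * (j : ℂ)) ≠ 0) :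
    AnalyticAt ℂ (uFactor n j) z := by
  have hO : IsOpen {w : ℂ | Sxi n (w + 2 * Real.pi * (j : ℂ)) ≠ 0} :=
    isOpen_ne_fun ((differentiable_Sxi n).continuous.comp (continuous_id.add continuous_const)) continuous_const
  exact DifferentiableOn.analyticAt (s := {w : ℂ | Sxi n (w + 2 * Real.pi * (j : ℂ)) ≠ 0})
    (fun w hw => (differentiableAt_uFactor_ne n j hj hw).differentiableWithinAt) (hO.mem_nhds h)

/-- `p ↦ u_n(j; p_λ)` is analytic (jointly in `p`) at every point of the fat region (`r ≤ 1/4`), every residue `j`.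
[folklore] -/
theorem analyticAt_uFactor_coord (n : ℕ) [NeZero n] (lam : Fin d) (j : Fin n) {r : ℝ} (hr : r ≤ 1 / 4)
    {q : Fin d → ℂ} (hq : q ∈ Fat d r) :
    AnalyticAt ℂ (fun p : Fin d → ℂ => uFactor n (j : ℕ) (p lam)) q := by
  have hn : 1 ≤ n := Nat.one_le_iff_ne_zero.mpr (NeZero.ne n)
  have hπ := Real.pi_gt_three
  have hF : AnalyticAt ℂ (uFactor n (j : ℕ)) (q lam) := by
    by_cases hj : (j : ℕ) = 0
    · rw [hj]
      exact analyticAt_uFactor_zero n hn (by linarith [(hq lam).1, hr, abs_nonneg ((q lam).re)])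
    · exact analyticAt_uFactor_ne n _ hj
        (Sxi_shift_ne_zero n _ (Nat.one_le_iff_ne_zero.mpr hj) j.isLt hr (hq lam).1)
  have h : AnalyticAt ℂ ((uFactor n (j : ℕ)) ∘ (fun p : Fin d → ℂ => p lam)) q :=
    hF.comp (f := fun p : Fin d → ℂ => p lam) (analyticAt_eval lam q)
  exact h

/-- `p ↦ U_n(k; p) = Π_μ u_n(k_μ; p_μ)` is analytic at every point of the fat region (`r ≤ 1/4`). [folklore] -/
theorem analyticAt_U (n : ℕ) [NeZero n] {r : ℝ} (hr : r ≤ 1 / 4) {q : Fin d → ℂ} (hq : q ∈ Fat d r)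
    (k : Fin d → Fin n) : AnalyticAt ℂ (fun p : Fin d → ℂ => U n k p) q := by
  simp only [U]
  exact Finset.analyticAt_fun_prod _ (fun ν _ => analyticAt_uFactor_coord n ν (k ν) hr hq)

/-- `p ↦ (Δ^ξ + m²)(p)` is analytic on `ℂ^d`. [folklore] -/
theorem analyticAt_DeltaXi (n : ℕ) (m2 : ℝ) (q : Fin d → ℂ) : AnalyticAt ℂ (DeltaXi n m2) q := by
  have h : AnalyticAt ℂ (fun p : Fin d → ℂ => (∑ μ, Sxi n (p μ)) + (m2 : ℂ)) q := by
    refine AnalyticAt.add ?_ analyticAt_const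
    refine Finset.analyticAt_fun_sum _ (fun μ _ => ?_)
    have h : AnalyticAt ℂ ((Sxi n) ∘ (fun p : Fin d → ℂ => p μ)) q :=
      (analyticAt_Sxi n (q μ)).comp (f := fun p : Fin d → ℂ => p μ) (analyticAt_eval μ q)
    exact h
  exact (by simpa [DeltaXi] using h : AnalyticAt ℂ (fun p => DeltaXi n m2 p) q)

/-- `p ↦ (Δ^ξ + m²)(p + 2πk)` is analytic on `ℂ^d`. [folklore] -/
theorem analyticAt_DeltaXi_shift (n : ℕ) (m2 : ℝ) (k : Fin d → Fin n) (q : Fin d → ℂ) :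
    AnalyticAt ℂ (fun p : Fin d → ℂ => DeltaXi n m2 (shift n k p)) q := by
  have hshift : AnalyticAt ℂ (fun p : Fin d → ℂ => shift n k p) q := by
    have : (fun p : Fin d → ℂ => shift n k p) =
        fun p => p + (fun μ => 2 * Real.pi * ((k μ : ℕ) : ℂ)) := by
      funext p; funext μ; simp [shift]
    rw [this]
    exact analyticAt_id.add analyticAt_const
  exact (analyticAt_DeltaXi n m2 (shift n k q)).comp hshift

/-- the regrouped ratio `R_n(k;·)` is analytic at every point of the fat region (`r ≤ 1/4`, `d r² ≤ 1/16`, `m² ≥ 0`),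
every `n ≥ 1`. [folklore] -/
theorem analyticAt_R (n : ℕ) [NeZero n] (m2 : ℝ) (hm : 0 ≤ m2) {r : ℝ} (hr : r ≤ 1 / 4)
    (hdr : (d : ℝ) * r ^ 2 ≤ 1 / 16) {q : Fin d → ℂ} (hq : q ∈ Fat d r) (k : Fin d → Fin n) :
    AnalyticAt ℂ (R n m2 k) q := by
  by_cases hk : k = fun _ => 0
  · have : R n m2 k = fun _ => (1 : ℂ) := by
      funext p; unfold R; rw [if_pos hk]
    rw [this]
    exact analyticAt_const
  · have : R n m2 k = fun p => DeltaXi n m2 p / DeltaXi n m2 (shift n k p) := by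
      funext p; unfold R; rw [if_neg hk]
    rw [this]
    exact (analyticAt_DeltaXi n m2 q).div (analyticAt_DeltaXi_shift n m2 k q)
      (DeltaXi_shift_ne_zero n m2 hm hr hdr hq k hk)

/-- **the numerator `numT n λ` is analytic at every point of the fat region** (`r ≤ 1/4`, `d r² ≤ 1/16`), every
`n ≥ 1`. [folklore] -/
theorem analyticAt_numT (n : ℕ) [NeZero n] (lam : Fin d) {r : ℝ} (hr : r ≤ 1 / 4)
    (hdr : (d : ℝ) * r ^ 2 ≤ 1 / 16) {q : Fin d → ℂ} (hq : q ∈ Fat d r) :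
    AnalyticAt ℂ (numT n lam) q := by
  have h : AnalyticAt ℂ (fun p => ∑ k ∈ Finset.univ.erase (fun _ => (0 : Fin n)),
      U n k p * uFactor n (k lam : ℕ) (p lam) * R n 0 k p) q := by
    refine Finset.analyticAt_fun_sum _ (fun k _ => ?_)
    exact ((analyticAt_U n hr hq k).mul (analyticAt_uFactor_coord n lam (k lam) hr hq)).mul
      (analyticAt_R n 0 le_rfl hr hdr hq k)
  exact (by simpa [numT] using h : AnalyticAt ℂ (fun p => numT n lam p) q)

/-- **the denominator `denT n λ` is analytic at every point of the fat region** (`r ≤ 1/4`), every `n ≥ 1`. [folklore] -/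
theorem analyticAt_denT (n : ℕ) [NeZero n] (lam : Fin d) {r : ℝ} (hr : r ≤ 1 / 4)
    {q : Fin d → ℂ} (hq : q ∈ Fat d r) : AnalyticAt ℂ (denT n lam) q := by
  have h0 := analyticAt_uFactor_coord n lam (0 : Fin n) hr hq
  simp only [Fin.val_zero] at h0
  have h : AnalyticAt ℂ (fun p => U n (fun _ => (0 : Fin n)) p * uFactor n 0 (p lam)) q :=
    (analyticAt_U n hr hq _).mul h0
  exact (by simpa [denT] using h : AnalyticAt ℂ (fun p => denT n lam p) q)

/-- **`tSubOne n λ` is ANALYTIC (jointly in `p ∈ ℂ^d`) at every point of the fat region** (`r ≤ 1/4`, `d r² ≤ 1/16`),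
for EVERY `n ≥ 1` and every `λ` — the strengthening of `Beta.AliasRatioStrip.differentiableAt_tSubOne` that Cauchy
iteration needs. [folklore] -/
theorem analyticAt_tSubOne (n : ℕ) [NeZero n] (lam : Fin d) {r : ℝ} (hr : r ≤ 1 / 4)
    (hdr : (d : ℝ) * r ^ 2 ≤ 1 / 16) {q : Fin d → ℂ} (hq : q ∈ Fat d r) :
    AnalyticAt ℂ (tSubOne n lam) q := by
  have h : AnalyticAt ℂ (fun p => numT n lam p / denT n lam p) q :=
    (analyticAt_numT n lam hr hdr hq).div (analyticAt_denT n lam hr hq) (denT_ne_zero n lam hr hq)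
  exact (by simpa [tSubOne] using h : AnalyticAt ℂ (fun p => tSubOne n lam p) q)

/-! ## §3. The corollaries for `t_λ − 1`: all-order k-uniform derivative bounds, and the vanishing order at `p = 0` -/

/-- a polydisc of radius `R` about a point of the strip `Strip d κ` lies in the fat region `F_r` as soon as `R ≤ r` and
`κ + R ≤ 2r`. [folklore] -/
theorem polyBox_subset_Fat {κ R r : ℝ} {c : Fin d → ℂ} (hc : c ∈ Strip d κ) (hRr : R ≤ r) (hκR : κ + R ≤ 2 * r) :
    PolyBox c R ⊆ Fat d r := by
  intro q hq ν
  have h1 : |(q ν - c ν).re| ≤ ‖q ν - c ν‖ := Complex.abs_re_le_norm _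
  have h2 : |(q ν - c ν).im| ≤ ‖q ν - c ν‖ := Complex.abs_im_le_norm _
  simp only [Complex.sub_re, Complex.sub_im] at h1 h2
  obtain ⟨hc1, hc2⟩ := hc ν
  have e1 := abs_sub_abs_le_abs_sub (q ν).re (c ν).re
  have e2 := abs_sub_abs_le_abs_sub (q ν).im (c ν).im
  exact ⟨by linarith [hq ν], by linarith [hq ν]⟩

/-- a polydisc of radius `ρ ≤ rOf d` about a point `c` with `‖c_ν‖ ≤ ρ` lies in the fat region `Fat d (rOf d)`, and
every point `q` of it has `‖q_ν‖ ≤ 2ρ`. [folklore] -/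
theorem polyBox_small_subset_Fat {ρ : ℝ} {c : Fin d → ℂ} (hc : ∀ ν, ‖c ν‖ ≤ ρ) (hρ : ρ ≤ rOf d) :
    PolyBox c ρ ⊆ Fat d (rOf d) ∧ ∀ q ∈ PolyBox c ρ, ∀ ν, ‖q ν‖ ≤ 2 * ρ := by
  have hπ := Real.pi_gt_three
  have hr4 := rOf_le d
  have hnorm : ∀ q ∈ PolyBox c ρ, ∀ ν, ‖q ν‖ ≤ 2 * ρ := by
    intro q hq ν
    calc ‖q ν‖ = ‖(q ν - c ν) + c ν‖ := by ring_nf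
      _ ≤ ‖q ν - c ν‖ + ‖c ν‖ := norm_add_le _ _
      _ ≤ ρ + ρ := add_le_add (hq ν) (hc ν)
      _ = 2 * ρ := by ring
  refine ⟨fun q hq ν => ?_, hnorm⟩
  have h := hnorm q hq ν
  have h1 : |(q ν).re| ≤ ‖q ν‖ := Complex.abs_re_le_norm _
  have h2 : |(q ν).im| ≤ ‖q ν‖ := Complex.abs_im_le_norm _
  exact ⟨by linarith, by linarith⟩

/-- **ALL-ORDER k-UNIFORM DERIVATIVE BOUNDS FOR `t_λ − 1`**: for EVERY `n = L^k ≥ 1`, every direction `λ`, every list of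
coordinates `α` (`m = |α|`) and every point `q` of a strip `Strip d κ` with `κ ≤ rOf d`:
`‖∂^α tSubOne n λ (q)‖ ≤ M_T(d) · (m / rOf d)^m` (Cauchy iteration on the polydisc of radius `rOf d` about `q`, which
lies in the fat region where `‖tSubOne‖ ≤ M_T(d)`, `Beta.AliasRatioStrip.norm_tSubOne_le`). [folklore] -/
theorem norm_iterSliceDeriv_tSubOne_le (n : ℕ) [NeZero n] (lam : Fin d) {κ : ℝ} (hκ : κ ≤ rOf d)
    {q : Fin d → ℂ} (hq : q ∈ Strip d κ) (α : List (Fin d)) :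
    ‖iterSliceDeriv (tSubOne n lam) α q‖ ≤ MT d * ((α.length : ℝ) / rOf d) ^ α.length := by
  have hsub : PolyBox q (rOf d) ⊆ Fat d (rOf d) := polyBox_subset_Fat hq le_rfl (by linarith)
  exact norm_iterSliceDeriv_center_le (tSubOne n lam) (rOf_pos d)
    (fun p hp => analyticAt_tSubOne n lam (rOf_le d) (d_mul_rOf_sq_le d) (hsub hp))
    (fun p hp => norm_tSubOne_le n lam (rOf_le d) (d_mul_rOf_sq_le d) (hsub hp)) α

/-- the same at every REAL momentum of the closed zone `[−π,π]^d`. [folklore] -/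
theorem norm_iterSliceDeriv_tSubOne_le_real (n : ℕ) [NeZero n] (lam : Fin d) {s : Fin d → ℝ}
    (hs : ∀ ν, |s ν| ≤ Real.pi) (α : List (Fin d)) :
    ‖iterSliceDeriv (tSubOne n lam) α (ofRealVec s)‖ ≤ MT d * ((α.length : ℝ) / rOf d) ^ α.length :=
  norm_iterSliceDeriv_tSubOne_le n lam (rOf_pos d).le (ofRealVec_mem_Strip_zero hs) α

/-- **VANISHING ORDER AT `p = 0`**: for EVERY `n ≥ 1`, `λ`, `α` (`m = |α|`), every `0 < ρ ≤ rOf d` and every `q` with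
`‖q_ν‖ ≤ ρ` for all `ν`: `‖∂^α tSubOne n λ (q)‖ ≤ C_T⁽⁴⁾(d)·(16 d² ρ⁴)·(m/ρ)^m` (Cauchy iteration on the polydisc of
radius `ρ` about `q`, on which `‖tSubOne‖ ≤ C_T⁽⁴⁾(d)(Σ‖p_ν‖²)² ≤ C_T⁽⁴⁾(d)·16d²ρ⁴` by
`Beta.AliasRatioStrip.norm_tSubOne_le_pow_four`). [folklore] -/
theorem norm_iterSliceDeriv_tSubOne_le_small (n : ℕ) [NeZero n] (lam : Fin d) {ρ : ℝ} (hρ : 0 < ρ)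
    (hρr : ρ ≤ rOf d) {q : Fin d → ℂ} (hq : ∀ ν, ‖q ν‖ ≤ ρ) (α : List (Fin d)) :
    ‖iterSliceDeriv (tSubOne n lam) α q‖ ≤
      CT4 d * (16 * (d : ℝ) ^ 2 * ρ ^ 4) * ((α.length : ℝ) / ρ) ^ α.length := by
  obtain ⟨hsub, hnorm⟩ := polyBox_small_subset_Fat hq hρr
  refine norm_iterSliceDeriv_center_le (tSubOne n lam) hρ
    (fun p hp => analyticAt_tSubOne n lam (rOf_le d) (d_mul_rOf_sq_le d) (hsub hp)) (fun p hp => ?_) α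
  have h1 := norm_tSubOne_le_pow_four n lam (rOf_le d) (d_mul_rOf_sq_le d) (hsub hp)
  have h2 : ∑ ν, ‖p ν‖ ^ 2 ≤ (d : ℝ) * (2 * ρ) ^ 2 := by
    calc ∑ ν, ‖p ν‖ ^ 2 ≤ ∑ _ν : Fin d, (2 * ρ) ^ 2 :=
          Finset.sum_le_sum (fun ν _ => pow_le_pow_left₀ (norm_nonneg _) (hnorm p hp ν) 2)
      _ = (d : ℝ) * (2 * ρ) ^ 2 := by simp
  have h0 : 0 ≤ ∑ ν, ‖p ν‖ ^ 2 := Finset.sum_nonneg (fun _ _ => by positivity)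
  calc ‖tSubOne n lam p‖ ≤ CT4 d * (∑ ν, ‖p ν‖ ^ 2) ^ 2 := h1
    _ ≤ CT4 d * ((d : ℝ) * (2 * ρ) ^ 2) ^ 2 :=
        mul_le_mul_of_nonneg_left (pow_le_pow_left₀ h0 h2 2) (CT4_nonneg d)
    _ = CT4 d * (16 * (d : ℝ) ^ 2 * ρ ^ 4) := by ring

/-- **VANISHING ORDER, CLEAN FORM (`m ≤ 4`)**: `‖∂^α tSubOne n λ (q)‖ ≤ 16 d² m^m · C_T⁽⁴⁾(d) · ρ^{4−m}` under the same
hypotheses — the kernel form of `|∂^α (t_λ − 1)(p′)| ≤ C_α |p′|^{4−|α|}` (HOME/BETA/AN1.md §15.4 (b); take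
`ρ = max_ν |p′_ν|`). [folklore] -/
theorem norm_iterSliceDeriv_tSubOne_le_vanishing (n : ℕ) [NeZero n] (lam : Fin d) {ρ : ℝ} (hρ : 0 < ρ)
    (hρr : ρ ≤ rOf d) {q : Fin d → ℂ} (hq : ∀ ν, ‖q ν‖ ≤ ρ) (α : List (Fin d)) (hm : α.length ≤ 4) :
    ‖iterSliceDeriv (tSubOne n lam) α q‖ ≤
      16 * (d : ℝ) ^ 2 * (α.length : ℝ) ^ α.length * CT4 d * ρ ^ (4 - α.length) := by
  have h := norm_iterSliceDeriv_tSubOne_le_small n lam hρ hρr hq α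
  have hm' : α.length + (4 - α.length) = 4 := Nat.add_sub_of_le hm
  have key : CT4 d * (16 * (d : ℝ) ^ 2 * ρ ^ 4) * ((α.length : ℝ) / ρ) ^ α.length =
      16 * (d : ℝ) ^ 2 * (α.length : ℝ) ^ α.length * CT4 d * ρ ^ (4 - α.length) := by
    rw [div_pow]
    have hρ4 : ρ ^ 4 = ρ ^ α.length * ρ ^ (4 - α.length) := by rw [← pow_add, hm']
    rw [hρ4]
    field_simp
  rw [key] at h
  exact h

/-- sanity: `iterSliceDeriv g [μ] = sliceDeriv g μ` and the first-order case of the strip bound is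
`Beta.AliasRatioStrip.norm_deriv_tSubOne_le` up to the harmless factor `(1/rOf d)^1`. -/
example (n : ℕ) [NeZero n] (lam μ : Fin d) {q : Fin d → ℂ} (hq : q ∈ Strip d 0) :
    ‖sliceDeriv (tSubOne n lam) μ q‖ ≤ MT d * ((1 : ℝ) / rOf d) ^ 1 := by
  simpa using norm_iterSliceDeriv_tSubOne_le n lam (rOf_pos d).le hq [μ]

end

end Literature.MathematicalPhysics.QuantumFieldTheory.Balaban1983to89.Beta.AliasRatioDerivs
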